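import Mathlib.Analysis.SpecialFunctions.Exp
import Mathlib.Analysis.SpecificLimits.Basic
import HarnessLib

/-!
# The two-frame squeeze: the real-analysis kernel of line `Sketch` (idea `euclidean-crossing-saturation`)
# for crux `CriticalContinuumLimit` (stmt-QuantumFields-8762)

Support file (`--supports stmt-QuantumFields-8762`).  The line "Euclidean crossing ⇒ plaquette
saturation" reads ONE bent third cumulant `κ₃(t, u)` of the lattice Yang–Mills torus state in the two
lattice frames related by the quarter-turn `e₀ ↔ e₁`: the longitudinal frame gives an upper bound
`|κ₃(⌊κu⌋, u)| ≤ K e^{-m_P κ u}` (spectral threshold `m_P` of the plaquette channel), the transverse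
frame a lower bound `c e^{-I u} ≤ |κ₃(⌊κu⌋, u)|`.  The kernel below is the elementary fact that the two
bounds are compatible only if `m_P κ ≤ I`; it is what turns the two frame readings into the plaquette
saturation inequality `m_P ≤ C₀ m⋆` of the line's skeleton
(`Cruxes/CriticalContinuumLimit/Lines/Sketch.lean`, `rate_le_of_frames`, `saturation_of_frames`).

* `twoFrameSqueeze` — continuous parameter, with a second (multi-particle) exponential on the right:
  eventually `c e^{-I u} ≤ A e^{-m_P κ u} + B e^{-ν u}`, `c > 0`, `I < ν` ⟹ `m_P κ ≤ I`
  (the ideator's kernel, crux-ideate round 1, proof carried over).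
* `crossingRate_le` — the one-term case through `twoFrameSqueeze`.
* `rate_le_of_eventually_nat` — the same along `u : ℕ` (the form the skeleton's frame readings,
  indexed by lattice separations, consume): eventually `c e^{-I u} ≤ K e^{-m_P κ u}` ⟹ `m_P κ ≤ I`.

Pure real analysis (Mathlib only). [folklore]
-/

open Filter Topology

namespace Summit.QuantumFields.YangMills.Theorems.CriticalContinuumLimit

/-- **Two-frame squeeze.** If eventually (in `u : ℝ`)
`c e^{-I u} ≤ A e^{-m_P κ u} + B e^{-ν u}` with `c > 0` and `I < ν`, then `m_P κ ≤ I`: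
otherwise both exponentials on the right decay strictly faster than the left-hand side, so
`c ≤ (|A| + |B|) e^{-δ u} → 0` with `δ = min(m_P κ, ν) - I > 0`. [folklore] -/
theorem twoFrameSqueeze (mP I κ c A B ν : ℝ) (hc : 0 < c) (hI : I < ν)
    (h : ∀ᶠ u : ℝ in atTop,
      c * Real.exp (-(I * u)) ≤ A * Real.exp (-(mP * κ * u)) + B * Real.exp (-(ν * u))) :
    mP * κ ≤ I := by
  by_contra hlt
  push Not at hlt
  set δ := min (mP * κ) ν - I with hδ
  have hδpos : 0 < δ := by rw [hδ]; exact sub_pos.mpr (lt_min hlt hI)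
  have hle1 : I + δ ≤ mP * κ := by rw [hδ]; linarith [min_le_left (mP * κ) ν]
  have hle2 : I + δ ≤ ν := by rw [hδ]; linarith [min_le_right (mP * κ) ν]
  have h2 : ∀ᶠ u : ℝ in atTop, c ≤ (|A| + |B|) * Real.exp (-(δ * u)) := by
    filter_upwards [h, eventually_ge_atTop (0 : ℝ)] with u hu hu0
    have e1 : A * Real.exp (-(mP * κ * u)) ≤ |A| * Real.exp (-((I + δ) * u)) := by
      calc A * Real.exp (-(mP * κ * u)) ≤ |A| * Real.exp (-(mP * κ * u)) :=
            mul_le_mul_of_nonneg_right (le_abs_self A) (Real.exp_pos _).le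
        _ ≤ |A| * Real.exp (-((I + δ) * u)) := by
            apply mul_le_mul_of_nonneg_left _ (abs_nonneg A)
            apply Real.exp_le_exp.mpr
            exact neg_le_neg (mul_le_mul_of_nonneg_right hle1 hu0)
    have e2 : B * Real.exp (-(ν * u)) ≤ |B| * Real.exp (-((I + δ) * u)) := by
      calc B * Real.exp (-(ν * u)) ≤ |B| * Real.exp (-(ν * u)) :=
            mul_le_mul_of_nonneg_right (le_abs_self B) (Real.exp_pos _).le
        _ ≤ |B| * Real.exp (-((I + δ) * u)) := by
            apply mul_le_mul_of_nonneg_left _ (abs_nonneg B)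
            apply Real.exp_le_exp.mpr
            exact neg_le_neg (mul_le_mul_of_nonneg_right hle2 hu0)
    have hsplit : Real.exp (-((I + δ) * u)) = Real.exp (-(I * u)) * Real.exp (-(δ * u)) := by
      rw [← Real.exp_add]; congr 1; ring
    have hE : 0 < Real.exp (-(I * u)) := Real.exp_pos _
    have h3 : c * Real.exp (-(I * u)) ≤
        ((|A| + |B|) * Real.exp (-(δ * u))) * Real.exp (-(I * u)) := by
      calc c * Real.exp (-(I * u)) ≤ A * Real.exp (-(mP * κ * u)) + B * Real.exp (-(ν * u)) := hu
        _ ≤ |A| * Real.exp (-((I + δ) * u)) + |B| * Real.exp (-((I + δ) * u)) := add_le_add e1 e2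
        _ = ((|A| + |B|) * Real.exp (-(δ * u))) * Real.exp (-(I * u)) := by rw [hsplit]; ring
    exact le_of_mul_le_mul_right h3 hE
  have hmul : Tendsto (fun u : ℝ => δ * u) atTop atTop := tendsto_id.const_mul_atTop hδpos
  have hexp : Tendsto (fun u : ℝ => Real.exp (-(δ * u))) atTop (𝓝 0) :=
    Real.tendsto_exp_neg_atTop_nhds_zero.comp hmul
  have h4 : Tendsto (fun u : ℝ => (|A| + |B|) * Real.exp (-(δ * u))) atTop (𝓝 0) := by
    simpa using hexp.const_mul (|A| + |B|)
  have h5 : ∀ᶠ u : ℝ in atTop, (|A| + |B|) * Real.exp (-(δ * u)) < c :=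
    h4.eventually (gt_mem_nhds hc)
  obtain ⟨u, hu1, hu2⟩ := (h2.and h5).exists
  exact absurd (lt_of_le_of_lt hu1 hu2) (lt_irrefl c)

/-- **Crossing rate bound**: an eventual upper bound `K e^{-m_P κ u}` and an eventual lower bound
`c e^{-I u}`, `c > 0`, on the modulus of one real function of `u : ℝ` force `m_P κ ≤ I`
(`twoFrameSqueeze` with no second exponential). [folklore] -/
theorem crossingRate_le (f : ℝ → ℝ) (mP I κ c K : ℝ) (hc : 0 < c)
    (hlong : ∀ᶠ u : ℝ in atTop, |f u| ≤ K * Real.exp (-(mP * κ * u)))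
    (htrans : ∀ᶠ u : ℝ in atTop, c * Real.exp (-(I * u)) ≤ |f u|) :
    mP * κ ≤ I := by
  refine twoFrameSqueeze mP I κ c K 0 (I + 1) hc (by linarith) ?_
  filter_upwards [hlong, htrans] with u h1 h2
  have : c * Real.exp (-(I * u)) ≤ K * Real.exp (-(mP * κ * u)) := h2.trans h1
  simpa using this

/-- **The squeeze along the natural numbers** (lattice separations): if eventually in `u : ℕ`
`c e^{-I u} ≤ K e^{-m_P κ u}` with `c > 0`, then `m_P κ ≤ I` — otherwise
`c ≤ K e^{-(m_P κ - I) u} → 0`. [folklore] -/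
theorem rate_le_of_eventually_nat (mP I κ c K : ℝ) (hc : 0 < c)
    (h : ∀ᶠ u : ℕ in atTop, c * Real.exp (-(I * u)) ≤ K * Real.exp (-(mP * κ * u))) :
    mP * κ ≤ I := by
  by_contra hlt
  push Not at hlt
  have hδ : 0 < mP * κ - I := sub_pos.mpr hlt
  have hev : ∀ᶠ u : ℕ in atTop, c ≤ K * Real.exp (-((mP * κ - I) * u)) := by
    filter_upwards [h] with u h3
    have hE : 0 < Real.exp (-(I * u)) := Real.exp_pos _
    have hsplit : K * Real.exp (-(mP * κ * u)) =
        (K * Real.exp (-((mP * κ - I) * u))) * Real.exp (-(I * u)) := by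
      have he : Real.exp (-(mP * κ * u)) =
          Real.exp (-((mP * κ - I) * u)) * Real.exp (-(I * u)) := by
        rw [← Real.exp_add]; congr 1; ring
      rw [he, mul_assoc]
    rw [hsplit] at h3
    exact le_of_mul_le_mul_right h3 hE
  have hlin : Tendsto (fun u : ℕ => (mP * κ - I) * (u : ℝ)) atTop atTop :=
    tendsto_natCast_atTop_atTop.const_mul_atTop hδ
  have ht : Tendsto (fun u : ℕ => K * Real.exp (-((mP * κ - I) * u))) atTop (𝓝 (K * 0)) :=
    (Real.tendsto_exp_neg_atTop_nhds_zero.comp hlin).const_mul K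
  rw [mul_zero] at ht
  obtain ⟨u, hu1, hu2⟩ := (hev.and (ht.eventually (gt_mem_nhds hc))).exists
  exact absurd (lt_of_le_of_lt hu1 hu2) (lt_irrefl c)

end Summit.QuantumFields.YangMills.Theorems.CriticalContinuumLimit
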